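import Mathlib.NumberTheory.EulerProduct.Basic
import Mathlib.NumberTheory.LSeries.Basic
import Mathlib.NumberTheory.SumPrimeReciprocals
import Mathlib.RingTheory.PowerSeries.Inverse
import Mathlib.Analysis.Normed.Ring.InfiniteSum
import Mathlib.Analysis.SpecificLimits.Normed
import Literature.NumberTheory.GaloisRepresentations.ArtinEulerFactorProofs
import Literature.NumberTheory.GaloisRepresentations.ArtinLFunctionProofs
import Literature.NumberTheory.GaloisRepresentations.ModNCyclotomicCharacter
import HarnessLib

/-!
# The Dirichlet coefficients of an Artin L-function over `ℚ`

Topic `Literature/NumberTheory/GaloisRepresentations`; namespace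
`Literature.NumberTheory.GaloisRepresentations`.  Definitions with bodies and proved theorems; no
named fact.

For an Artin representation `ρ : Γ_ℚ → GL(V)` the Artin L-function is the Euler product
`L(s, ρ) = ∏_p L_p(ρ, p^{-s})⁻¹`, `L_p(ρ, T) = det(1 - T ρ(Frob_p) | V^{I_p})`
(`artinLFunction`, Neukirch VII (10.1)).  Expanding each `L_p(ρ, T)⁻¹ = ∑_k c_p(k) T^k` as a power
series and multiplying out gives the **Dirichlet series** `L(s, ρ) = ∑_{n ≥ 1} a_n n^{-s}` with
MULTIPLICATIVE coefficients `a_{∏ p^{k_p}} = ∏ c_p(k_p)` (Booker 2003, eq. (4) p. 1091: "`a_n` the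
Dirichlet coefficients of `L(s, ρ)`"; Neukirch VII §8 (8.1)–(8.2) for the abelian case; for a
general Euler product of degree `n` this expansion is e.g. Iwaniec–Kowalski, *Analytic Number
Theory*, §5.1, (5.1)–(5.3)).  This file defines these coefficients and proves the expansion:

* `ArtinRep.localCoeff ρ v k` — `c_v(k)`, the `k`-th coefficient of the power series
  `L_v(ρ, T)⁻¹ ∈ ℂ⟦T⟧` (Mathlib `PowerSeries` inverse; `L_v(ρ, 0) = 1`);
* `ArtinRep.dirichletCoeff ρ : ℕ → ℂ` — `a_n = ∏_{p^k ∥ n} c_p(k)` (`a_0 = 0`, `a_1 = 1`),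
  multiplicative on coprime arguments (`dirichletCoeff_mul_of_coprime`), with
  `dirichletCoeff_prime_pow : a_{p^k} = c_p(k)`;
* `ArtinRep.norm_localCoeff_le` — `|c_v(k)| ≤ (k + 1)^{dim V}`: `L_v(ρ, T) = ∏_{i ≤ d} (1 - β_i T)`
  with roots of unity `β_i`, `d ≤ dim V` (`ArtinRep.exists_card_le_eval_eulerFactorAt_eq_prod`), so
  `L_v⁻¹ = ∏ (∑_k β_i^k T^k)` has coefficients bounded by the number of compositions;
* `ArtinRep.LSeriesSummable_dirichletCoeff` — `∑ |a_n n^{-s}| < ∞` for `Re s > 1`, WITHOUT a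
  pointwise divisor bound: a multiplicative function with bounded absolute Euler products is
  summable (`summable_norm_of_summable_norm_prime_pow`, from Mathlib's
  `EulerProduct.summable_and_hasSum_factoredNumbers_prod_filter_prime_tsum`), and here
  `∑_{k ≥ 1} |c_p(k)| p^{-kσ} ≤ K p^{-σ}` (`tsum_norm_term_prime_pow_le`);
* `ArtinRep.tsum_localCoeff_mul_pow` — `∑_k c_v(k) z^k = L_v(ρ, z)⁻¹` for `|z| < 1` (Cauchy
  product with the polynomial `L_v`);
* `ArtinRep.LSeries_dirichletCoeff_eq_artinLFunction` — **`∑ a_n n^{-s} = L(s, ρ)` for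
  `Re s > 1`** (Mathlib `EulerProduct.eulerProduct_hasProd`, reindexed along
  `Rat.HeightOneSpectrum.primesEquiv`), and `LSeriesSummable (dirichletCoeff ρ) s` there.

These are the objects `a_n` of Booker's Lemma 1 (`Automorphic/BookerStrongArtin`,
`booker_additiveTwist_meromorphic`: "for every coefficient sequence `a` with
`∑ a_n n^{-s} = L(s, σ)` on `Re s > 1`"), which this file shows to exist and computes prime by
prime; the behaviour under character twists and removal of finitely many Euler factors is left to
sequel files.

## References

* A. R. Booker, *Poles of Artin L-functions and the strong Artin conjecture*, Ann. of Math. 158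
  (2003), eq. (4) p. 1091 and pp. 1092–1093. [Booker2003]
* J. Neukirch, *Algebraic Number Theory* (1999), Ch. VII §10 (10.1); §8 (8.1)–(8.2). [NeukirchANT1999]
* P. Deligne, J.-P. Serre, *Formes modulaires de poids 1*, Ann. Sci. ÉNS 7 (1974), proof of
  Thm. 4.6 (iv) (Frobenius eigenvalues are roots of unity) and §9 (the Dirichlet series of an
  Artin L-function). [DeligneSerreASENS1974]

## Mathlib / tree search

Mathlib: `PowerSeries` inverse over a field (`PowerSeries.eq_inv_iff_mul_eq_one`,
`PowerSeries.coeff_mul`), `EulerProduct.eulerProduct_hasProd`,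
`EulerProduct.summable_and_hasSum_factoredNumbers_prod_filter_prime_tsum`,
`tsum_mul_tsum_eq_tsum_sum_antidiagonal_of_summable_norm`, `Nat.factorization`,
`Rat.HeightOneSpectrum.primesEquiv`, `LSeries`; no Dirichlet coefficients of Euler products of
degree `> 1` (`DirichletCharacter.LSeries_eulerProduct` is degree `1`).  Tree: the degree-`2`
newform case `Automorphic.LSeries_hasProd_of_recurrence` (`LanglandsTunnellLSeriesProofs`, from
given coefficients to the Euler product — the converse direction), `ArtinRep.eulerFactorAt_coeff_zero`,
`ArtinRep.exists_card_le_eval_eulerFactorAt_eq_prod`, `ArtinRep.finite_range_holds`,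
`multipliable_artinLFunction_holds`; `lean search 'dirichletCoeff|localCoeff|artinCoeff'`: nothing
for Artin representations before this file.
-/

noncomputable section

open scoped NumberField
open Field IsDedekindDomain Module NumberField Polynomial Complex Filter Finset
open Rat.HeightOneSpectrum

namespace Literature.NumberTheory.GaloisRepresentations

universe w

namespace ArtinRep

variable {V : Type w} [AddCommGroup V] [Module ℂ V] [TopologicalSpace V] [FiniteDimensional ℂ V]

/-! ### Local coefficients: the power series `L_v(ρ, T)⁻¹` -/

/-- The **local Dirichlet coefficients** `c_v(k)` of `ρ` at the finite place `v` of `ℚ`: the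
coefficients of the power series `L_v(ρ, T)⁻¹ = ∑_k c_v(k) T^k ∈ ℂ⟦T⟧` (the Euler factor
`L_v(ρ, T) = det(1 - T Frob | V^{I})` has constant term `1`, so it is invertible in `ℂ⟦T⟧`).
Ref: Neukirch, *Algebraic Number Theory*, VII §10 (10.1); Booker 2003, (4). [cite: Booker2003, eq. (4) p. 1091] -/
def localCoeff (ρ : ArtinRep ℚ V) (v : HeightOneSpectrum (𝓞 ℚ)) (k : ℕ) : ℂ :=
  PowerSeries.coeff k ((ρ.eulerFactorAt v : PowerSeries ℂ)⁻¹)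

/-- The Euler factor has constant coefficient `1` as a power series. [folklore] -/
theorem constantCoeff_coe_eulerFactorAt (ρ : ArtinRep ℚ V) (v : HeightOneSpectrum (𝓞 ℚ)) :
    PowerSeries.constantCoeff (ρ.eulerFactorAt v : PowerSeries ℂ) = 1 := by
  rw [← PowerSeries.coeff_zero_eq_constantCoeff_apply, Polynomial.coeff_coe,
    eulerFactorAt_coeff_zero]

/-- `c_v(0) = 1`. [folklore] -/
@[simp] theorem localCoeff_zero (ρ : ArtinRep ℚ V) (v : HeightOneSpectrum (𝓞 ℚ)) :
    ρ.localCoeff v 0 = 1 := by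
  rw [localCoeff, PowerSeries.coeff_zero_eq_constantCoeff_apply, PowerSeries.constantCoeff_inv,
    constantCoeff_coe_eulerFactorAt, inv_one]

/-- Defining identity: `L_v(ρ, T) · (∑_k c_v(k) T^k) = 1` in `ℂ⟦T⟧`. [folklore] -/
theorem coe_eulerFactorAt_mul_mk_localCoeff (ρ : ArtinRep ℚ V) (v : HeightOneSpectrum (𝓞 ℚ)) :
    (ρ.eulerFactorAt v : PowerSeries ℂ) * PowerSeries.mk (ρ.localCoeff v) = 1 := by
  have h : PowerSeries.mk (ρ.localCoeff v) = (ρ.eulerFactorAt v : PowerSeries ℂ)⁻¹ :=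
    PowerSeries.ext fun k => by rw [PowerSeries.coeff_mk, localCoeff]
  rw [h, PowerSeries.mul_inv_cancel _ (by rw [constantCoeff_coe_eulerFactorAt]; exact one_ne_zero)]

/-- The convolution identity of the local coefficients: for `k ≥ 1`,
`∑_{i + j = k} e_i c_v(j) = 0`, `e_i` the coefficients of `L_v(ρ, T)`. [folklore] -/
theorem sum_antidiagonal_coeff_mul_localCoeff (ρ : ArtinRep ℚ V) (v : HeightOneSpectrum (𝓞 ℚ))
    (k : ℕ) :
    ∑ ij ∈ Finset.antidiagonal k, (ρ.eulerFactorAt v).coeff ij.1 * ρ.localCoeff v ij.2 =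
      if k = 0 then 1 else 0 := by
  have h := congrArg (PowerSeries.coeff k) (ρ.coe_eulerFactorAt_mul_mk_localCoeff v)
  rw [PowerSeries.coeff_mul, PowerSeries.coeff_one] at h
  simpa only [Polynomial.coeff_coe, PowerSeries.coeff_mk] using h

/-! ### The global coefficients `a_n` -/

/-- The local coefficient at the rational prime `p` and exponent `k`, as a function of an arbitrary
natural number `p` (value `1` at non-primes, which never occur in `Nat.factorization`). [folklore] -/
def localCoeffNat (ρ : ArtinRep ℚ V) (p k : ℕ) : ℂ :=
  if hp : p.Prime then ρ.localCoeff ((primesEquiv (R := 𝓞 ℚ)).symm ⟨p, hp⟩) k else 1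

/-- `localCoeffNat` at a prime is `localCoeff` at the place above it. [folklore] -/
theorem localCoeffNat_of_prime (ρ : ArtinRep ℚ V) {p : ℕ} (hp : p.Prime) (k : ℕ) :
    ρ.localCoeffNat p k = ρ.localCoeff ((primesEquiv (R := 𝓞 ℚ)).symm ⟨p, hp⟩) k := by
  rw [localCoeffNat, dif_pos hp]

/-- `localCoeffNat p 0 = 1`. [folklore] -/
@[simp] theorem localCoeffNat_zero (ρ : ArtinRep ℚ V) (p : ℕ) : ρ.localCoeffNat p 0 = 1 := by
  unfold localCoeffNat
  split_ifs <;> simp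

/-- The **Dirichlet coefficients** `a_n` of `L(s, ρ)`: `a_0 = 0` and, for `n = ∏ p^{k_p} ≥ 1`,
`a_n = ∏_p c_p(k_p)` (product over `Nat.factorization n`).  Booker 2003, (4): "`a_n` the
Dirichlet coefficients of `L(s, ρ)`"; that `∑ a_n n^{-s} = L(s, ρ)` on `Re s > 1` is
`LSeries_dirichletCoeff_eq_artinLFunction` below. [cite: Booker2003, eq. (4) p. 1091] -/
def dirichletCoeff (ρ : ArtinRep ℚ V) (n : ℕ) : ℂ :=
  if n = 0 then 0 else n.factorization.prod (ρ.localCoeffNat)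

/-- `a_0 = 0`. [folklore] -/
@[simp] theorem dirichletCoeff_zero (ρ : ArtinRep ℚ V) : ρ.dirichletCoeff 0 = 0 := by
  rw [dirichletCoeff, if_pos rfl]

/-- Unfolding at `n ≠ 0`. [folklore] -/
theorem dirichletCoeff_of_ne_zero (ρ : ArtinRep ℚ V) {n : ℕ} (hn : n ≠ 0) :
    ρ.dirichletCoeff n = n.factorization.prod ρ.localCoeffNat := by
  rw [dirichletCoeff, if_neg hn]

/-- `a_1 = 1`. [folklore] -/
@[simp] theorem dirichletCoeff_one (ρ : ArtinRep ℚ V) : ρ.dirichletCoeff 1 = 1 := by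
  rw [dirichletCoeff_of_ne_zero ρ one_ne_zero, Nat.factorization_one, Finsupp.prod_zero_index]

/-- **Multiplicativity**: `a_{mn} = a_m a_n` for coprime `m, n`. [cite: Booker2003, proof of Lemma 1 (p. 1092, "by multiplicativity")] -/
theorem dirichletCoeff_mul_of_coprime (ρ : ArtinRep ℚ V) {m n : ℕ} (hmn : m.Coprime n) :
    ρ.dirichletCoeff (m * n) = ρ.dirichletCoeff m * ρ.dirichletCoeff n := by
  rcases eq_or_ne m 0 with rfl | hm
  · simp
  rcases eq_or_ne n 0 with rfl | hn
  · simp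
  rw [dirichletCoeff_of_ne_zero ρ (mul_ne_zero hm hn), dirichletCoeff_of_ne_zero ρ hm,
    dirichletCoeff_of_ne_zero ρ hn, Nat.factorization_mul_of_coprime hmn,
    Finsupp.prod_add_index_of_disjoint]
  rw [Nat.support_factorization, Nat.support_factorization]
  exact hmn.disjoint_primeFactors

/-- **Prime powers**: `a_{p^k} = c_p(k)`. [cite: Booker2003, proof of Lemma 1 (p. 1093, (8))] -/
theorem dirichletCoeff_prime_pow (ρ : ArtinRep ℚ V) {p : ℕ} (hp : p.Prime) (k : ℕ) :
    ρ.dirichletCoeff (p ^ k) = ρ.localCoeff ((primesEquiv (R := 𝓞 ℚ)).symm ⟨p, hp⟩) k := by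
  rw [dirichletCoeff_of_ne_zero ρ (pow_ne_zero k hp.ne_zero), hp.factorization_pow,
    Finsupp.prod_single_index (ρ.localCoeffNat_zero p), localCoeffNat_of_prime ρ hp]

/-- `a_p = c_p(1)` at a prime `p`. [folklore] -/
theorem dirichletCoeff_prime (ρ : ArtinRep ℚ V) {p : ℕ} (hp : p.Prime) :
    ρ.dirichletCoeff p = ρ.localCoeff ((primesEquiv (R := 𝓞 ℚ)).symm ⟨p, hp⟩) 1 := by
  rw [← dirichletCoeff_prime_pow ρ hp 1, pow_one]

end ArtinRep

/-! ### Places of `ℚ` and rational primes -/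

/-- `N v = p_v` for a finite place `v` of `ℚ` (`p_v = natGenerator v` the rational prime under `v`;
the same statement as `Rat.residueCard_eq_natGenerator` of `HeckeCharacterProofs`, reproved here to
keep this file's imports light). [folklore] -/
theorem Rat.residueCard_eq_natGenerator' (v : HeightOneSpectrum (𝓞 ℚ)) :
    v.residueCard = natGenerator v := by
  have h : Ideal.span {(natGenerator v : ℤ)} =
      v.asIdeal.map (Rat.IsIntegralClosure.intEquiv (𝓞 ℚ) : 𝓞 ℚ →+* ℤ) := span_natGenerator v
  rw [v.residueCard_eq_card_quotient, Nat.card_congr ((Ideal.quotientEquiv _ _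
    (Rat.IsIntegralClosure.intEquiv (𝓞 ℚ)) h).trans (Int.quotientSpanNatEquivZMod _)).toEquiv,
    Nat.card_zmod]

/-- The rational prime under the place `primesEquiv.symm p` is `p`. [folklore] -/
@[simp] theorem Rat.natGenerator_primesEquiv_symm (p : Nat.Primes) :
    natGenerator ((primesEquiv (R := 𝓞 ℚ)).symm p) = p := by
  have h := (primesEquiv (R := 𝓞 ℚ)).apply_symm_apply p
  exact congrArg Subtype.val h


/-! ### Geometric power series and coefficient bounds -/

/-- `(1 - β T) · ∑_k β^k T^k = 1` in `ℂ⟦T⟧`. [folklore] -/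
theorem coe_one_sub_C_mul_X_mul_mk_pow (β : ℂ) :
    ((1 - C β * X : ℂ[X]) : PowerSeries ℂ) * PowerSeries.mk (fun k => β ^ k) = 1 := by
  rw [Polynomial.coe_sub, Polynomial.coe_one, Polynomial.coe_mul, Polynomial.coe_C,
    Polynomial.coe_X, sub_mul, one_mul, mul_assoc]
  refine PowerSeries.ext fun k => ?_
  rw [map_sub, PowerSeries.coeff_one]
  cases k with
  | zero => simp
  | succ k =>
    rw [PowerSeries.coeff_mk, ← mul_assoc, mul_comm (PowerSeries.C β), mul_assoc,
      PowerSeries.coeff_succ_X_mul, PowerSeries.coeff_C_mul, PowerSeries.coeff_mk, if_neg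
      (Nat.succ_ne_zero k), pow_succ]
    ring

/-- **Coefficient bound for a product of geometric series**: if `|β| = 1` for all `β ∈ B` then the
`k`-th coefficient of `∏_{β ∈ B} ∑_j β^j T^j` has absolute value at most `(k + 1)^{#B}` (at most the
number of compositions of `k` into `#B` parts). [folklore] -/
theorem norm_coeff_prod_mk_pow_le (B : Multiset ℂ) (hB : ∀ β ∈ B, ‖β‖ = 1) (k : ℕ) :
    ‖PowerSeries.coeff k (B.map fun β => PowerSeries.mk fun j => β ^ j).prod‖ ≤
      ((k : ℝ) + 1) ^ Multiset.card B := by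
  induction B using Multiset.induction_on generalizing k with
  | empty =>
    simp only [Multiset.map_zero, Multiset.prod_zero, PowerSeries.coeff_one, Multiset.card_zero,
      pow_zero]
    split_ifs <;> simp
  | cons β B ih =>
    have hβ : ‖β‖ = 1 := hB β (Multiset.mem_cons_self β B)
    have hB' : ∀ γ ∈ B, ‖γ‖ = 1 := fun γ hγ => hB γ (Multiset.mem_cons_of_mem hγ)
    rw [Multiset.map_cons, Multiset.prod_cons, PowerSeries.coeff_mul, Multiset.card_cons, pow_succ]
    calc ‖∑ ij ∈ Finset.antidiagonal k, PowerSeries.coeff ij.1 (PowerSeries.mk fun j => β ^ j) *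
            PowerSeries.coeff ij.2 (B.map fun β => PowerSeries.mk fun j => β ^ j).prod‖
        ≤ ∑ ij ∈ antidiagonal k, ‖PowerSeries.coeff ij.1 (PowerSeries.mk fun j => β ^ j) *
            PowerSeries.coeff ij.2 (B.map fun β => PowerSeries.mk fun j => β ^ j).prod‖ :=
          norm_sum_le _ _
      _ ≤ ∑ _ij ∈ Finset.antidiagonal k, ((k : ℝ) + 1) ^ Multiset.card B := by
          refine Finset.sum_le_sum fun ij hij => ?_
          rw [norm_mul, PowerSeries.coeff_mk, norm_pow, hβ, one_pow, one_mul]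
          have hj : ij.2 ≤ k := by
            rw [Finset.mem_antidiagonal] at hij
            omega
          calc ‖PowerSeries.coeff ij.2 (B.map fun β => PowerSeries.mk fun j => β ^ j).prod‖
              ≤ ((ij.2 : ℝ) + 1) ^ Multiset.card B := ih hB' ij.2
            _ ≤ ((k : ℝ) + 1) ^ Multiset.card B := by gcongr
      _ = ((k : ℝ) + 1) ^ Multiset.card B * ((k : ℝ) + 1) := by
          rw [Finset.sum_const, Finset.Nat.card_antidiagonal, nsmul_eq_mul, Nat.cast_add,
            Nat.cast_one, mul_comm]

namespace ArtinRep


variable {V : Type w} [AddCommGroup V] [Module ℂ V] [TopologicalSpace V] [FiniteDimensional ℂ V]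

/-- **The Euler factor as a product of linear factors, polynomial form**: for an Artin
representation of `ℚ` with finite image (module topology), `L_v(ρ, T) = ∏_{β ∈ B} (1 - β T)` in
`ℂ[T]` for a multiset `B` of at most `dim V` complex numbers of absolute value `1`
(`exists_card_le_eval_eulerFactorAt_eq_prod` at every `z`, and `Polynomial.funext`).
[cite: DeligneSerreASENS1974, §4 (b) proof of Thm. 4.6 (iv)] -/
theorem exists_eulerFactorAt_eq_multiset_prod [IsModuleTopology ℂ V] (ρ : ArtinRep ℚ V)
    (v : HeightOneSpectrum (𝓞 ℚ)) :
    ∃ B : Multiset ℂ, Multiset.card B ≤ finrank ℂ V ∧ (∀ β ∈ B, ‖β‖ = 1) ∧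
      ρ.eulerFactorAt v = (B.map fun β => (1 - C β * X : ℂ[X])).prod := by
  obtain ⟨B, hcard, hB, heval⟩ :=
    ρ.exists_card_le_eval_eulerFactorAt_eq_prod (finite_range_holds ρ) v
  refine ⟨B, hcard, hB, Polynomial.funext fun z => ?_⟩
  rw [heval z, Polynomial.eval_multiset_prod, Multiset.map_map]
  congr 1
  refine Multiset.map_congr rfl fun β _ => ?_
  simp

/-- The power series `∑_k c_v(k) T^k` is the product of the geometric series `∑_j β^j T^j` over
the inverse roots `β` of the Euler factor. [folklore] -/
theorem mk_localCoeff_eq_multiset_prod [IsModuleTopology ℂ V] (ρ : ArtinRep ℚ V)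
    (v : HeightOneSpectrum (𝓞 ℚ)) {B : Multiset ℂ}
    (hE : ρ.eulerFactorAt v = (B.map fun β => (1 - C β * X : ℂ[X])).prod) :
    PowerSeries.mk (ρ.localCoeff v) = (B.map fun β => PowerSeries.mk fun j => β ^ j).prod := by
  -- both sides are inverses of `L_v(ρ, T)` in `ℂ⟦T⟧`
  have h1 : (ρ.eulerFactorAt v : PowerSeries ℂ) *
      (B.map fun β => PowerSeries.mk fun j => β ^ j).prod = 1 := by
    rw [hE, ← Polynomial.coeToPowerSeries.ringHom_apply, map_multiset_prod, Multiset.map_map,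
      ← Multiset.prod_map_mul]
    refine Multiset.prod_eq_one fun x hx => ?_
    obtain ⟨β, -, rfl⟩ := Multiset.mem_map.mp hx
    exact coe_one_sub_C_mul_X_mul_mk_pow β
  have hc : PowerSeries.constantCoeff (ρ.eulerFactorAt v : PowerSeries ℂ) ≠ 0 := by
    rw [constantCoeff_coe_eulerFactorAt]; exact one_ne_zero
  have h2 := ρ.coe_eulerFactorAt_mul_mk_localCoeff v
  rw [mul_comm] at h1 h2
  rw [(PowerSeries.eq_inv_iff_mul_eq_one hc).mpr h2, (PowerSeries.eq_inv_iff_mul_eq_one hc).mpr h1]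

/-- **`|c_v(k)| ≤ (k + 1)^{dim V}`** for the local Dirichlet coefficients of an Artin representation
of `ℚ` (finite image): the `k`-th coefficient of `∏_{i ≤ d} (1 - β_i T)⁻¹`, `|β_i| = 1`,
`d ≤ dim V`. [cite: DeligneSerreASENS1974, §4 (b) proof of Thm. 4.6 (iv)] -/
theorem norm_localCoeff_le [IsModuleTopology ℂ V] (ρ : ArtinRep ℚ V) (v : HeightOneSpectrum (𝓞 ℚ))
    (k : ℕ) : ‖ρ.localCoeff v k‖ ≤ ((k : ℝ) + 1) ^ finrank ℂ V := by
  obtain ⟨B, hcard, hB, hE⟩ := ρ.exists_eulerFactorAt_eq_multiset_prod v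
  have h := congrArg (PowerSeries.coeff k) (ρ.mk_localCoeff_eq_multiset_prod v hE)
  rw [PowerSeries.coeff_mk] at h
  rw [h]
  calc _ ≤ ((k : ℝ) + 1) ^ Multiset.card B := norm_coeff_prod_mk_pow_le B hB k
    _ ≤ ((k : ℝ) + 1) ^ finrank ℂ V :=
        pow_le_pow_right₀ (by simp) hcard

/-- The Euler factor does not vanish on the open unit disc (`|β z| < 1` for every inverse root).
[folklore] -/
theorem eval_eulerFactorAt_ne_zero_of_norm_lt_one [IsModuleTopology ℂ V] (ρ : ArtinRep ℚ V)
    (v : HeightOneSpectrum (𝓞 ℚ)) {z : ℂ} (hz : ‖z‖ < 1) : (ρ.eulerFactorAt v).eval z ≠ 0 := by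
  obtain ⟨B, -, hB, hE⟩ := ρ.exists_eulerFactorAt_eq_multiset_prod v
  rw [hE, Polynomial.eval_multiset_prod, Multiset.map_map]
  refine Multiset.prod_ne_zero fun h0 => ?_
  obtain ⟨β, hβ, h⟩ := Multiset.mem_map.mp h0
  simp only [Function.comp_apply, eval_sub, eval_one, eval_mul, eval_C, eval_X] at h
  have : ‖β * z‖ < 1 := by rw [norm_mul, hB β hβ, one_mul]; exact hz
  rw [sub_eq_zero] at h
  rw [← h, norm_one] at this
  exact lt_irrefl _ this

/-! ### `∑_k c_v(k) z^k = L_v(ρ, z)⁻¹` on the unit disc -/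

/-- Absolute convergence of `∑_k c_v(k) z^k` for `|z| < 1` (coefficients of polynomial growth).
[folklore] -/
theorem summable_norm_localCoeff_mul_pow [IsModuleTopology ℂ V] (ρ : ArtinRep ℚ V)
    (v : HeightOneSpectrum (𝓞 ℚ)) {z : ℂ} (hz : ‖z‖ < 1) :
    Summable fun k : ℕ => ‖ρ.localCoeff v k * z ^ k‖ := by
  have hs : Summable fun k : ℕ => ‖(((k + 1) ^ finrank ℂ V : ℕ) : ℂ) * z ^ k‖ := by
    refine summable_norm_mul_geometric_of_norm_lt_one (k := finrank ℂ V) hz ?_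
    -- `(k+1)^d = O(k^d)`
    have h2 : (fun k : ℕ => (((k + 1) ^ finrank ℂ V : ℕ) : ℝ)) =O[atTop]
        fun k : ℕ => ((k ^ finrank ℂ V : ℕ) : ℝ) := by
      simp only [Nat.cast_pow, Nat.cast_add, Nat.cast_one]
      refine (Asymptotics.IsBigO.pow ?_ _)
      refine Asymptotics.IsBigO.add (Asymptotics.isBigO_refl _ _) ?_
      refine Asymptotics.IsBigO.of_bound 1 ?_
      filter_upwards [Filter.eventually_ge_atTop 1] with k hk
      simp only [norm_one, Real.norm_natCast, one_mul, Nat.one_le_cast]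
      exact hk
    exact h2
  refine hs.of_nonneg_of_le (fun _ => norm_nonneg _) fun k => ?_
  rw [norm_mul, norm_mul]
  refine mul_le_mul_of_nonneg_right ?_ (norm_nonneg _)
  calc ‖ρ.localCoeff v k‖ ≤ ((k : ℝ) + 1) ^ finrank ℂ V := ρ.norm_localCoeff_le v k
    _ = ‖(((k + 1) ^ finrank ℂ V : ℕ) : ℂ)‖ := by
        rw [Complex.norm_natCast]; push_cast; ring

/-- **`∑_k c_v(k) z^k = L_v(ρ, z)⁻¹` for `|z| < 1`**: the Cauchy product of the (finite) series
`L_v(ρ, z) = ∑ e_i z^i` with `∑_k c_v(k) z^k` is `∑_n (∑_{i+j=n} e_i c_v(j)) z^n = 1`.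
Ref: Neukirch, *Algebraic Number Theory*, VII §10, remark after (10.1). [folklore] -/
theorem tsum_localCoeff_mul_pow [IsModuleTopology ℂ V] (ρ : ArtinRep ℚ V)
    (v : HeightOneSpectrum (𝓞 ℚ)) {z : ℂ} (hz : ‖z‖ < 1) :
    ∑' k : ℕ, ρ.localCoeff v k * z ^ k = ((ρ.eulerFactorAt v).eval z)⁻¹ := by
  set E := ρ.eulerFactorAt v with hEdef
  -- the finitely supported series of `E`
  set e : ℕ → ℂ := fun i => E.coeff i * z ^ i with he
  have hesupp : ∀ i ∉ Finset.range (E.natDegree + 1), e i = 0 := fun i hi => by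
    simp only [Finset.mem_range, not_lt] at hi
    show E.coeff i * z ^ i = 0
    rw [Polynomial.coeff_eq_zero_of_natDegree_lt (Nat.lt_of_succ_le hi), zero_mul]
  have hesum : Summable fun i => ‖e i‖ :=
    summable_of_ne_finset_zero (s := Finset.range (E.natDegree + 1)) fun i hi => by
      rw [hesupp i hi, norm_zero]
  have heval : ∑' i, e i = E.eval z := by
    rw [tsum_eq_sum hesupp, Polynomial.eval_eq_sum_range]
  -- Cauchy product
  have hprod := tsum_mul_tsum_eq_tsum_sum_antidiagonal_of_summable_norm hesum
    (ρ.summable_norm_localCoeff_mul_pow v hz)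
  have hinner : ∀ n : ℕ, ∑ ij ∈ Finset.antidiagonal n, e ij.1 * (ρ.localCoeff v ij.2 * z ^ ij.2) =
      (if n = 0 then 1 else 0) * z ^ n := by
    intro n
    rw [← ρ.sum_antidiagonal_coeff_mul_localCoeff v n, Finset.sum_mul]
    refine Finset.sum_congr rfl fun ij hij => ?_
    rw [Finset.mem_antidiagonal] at hij
    rw [he, ← hij, pow_add]
    ring
  simp_rw [hinner] at hprod
  have hR : ∑' n : ℕ, (if n = 0 then (1 : ℂ) else 0) * z ^ n = 1 := by
    rw [tsum_eq_single 0 (fun n hn => by rw [if_neg hn, zero_mul]), if_pos rfl, pow_zero, mul_one]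
  rw [hR, heval] at hprod
  exact (inv_eq_of_mul_eq_one_right hprod).symm

end ArtinRep

/-! ### Summability of multiplicative functions from their prime-power sums -/

/-- A product over the primes of a finset of naturals is a product over the corresponding finset
of `Nat.Primes`. [folklore] -/
theorem prod_filter_prime_eq_prod_subtype {M : Type*} [CommMonoid M] (g : ℕ → M) (s : Finset ℕ) :
    ∏ p ∈ s with p.Prime, g p = ∏ q ∈ (s.subtype Nat.Prime : Finset Nat.Primes), g q := by
  rw [← Finset.subtype_map (p := Nat.Prime) (s := s), Finset.prod_map]
  rfl

/-- **A multiplicative function with bounded absolute Euler products is absolutely summable.**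
Let `f : ℕ → ℂ` satisfy `f 1 = 1`, `f (m n) = f m f n` for coprime `m, n`, suppose
`∑_k |f(p^k)| < ∞` for every prime `p` and `∏_{p ∈ s prime} ∑_k |f(p^k)| ≤ B` for every finite
set `s`.  Then `∑_n |f n| < ∞`: every `1 ≤ n ≤ N` is `{p ≤ N}`-factored, so the partial sums of
`|f|` are bounded by `|f 0| + B` (Mathlib
`EulerProduct.summable_and_hasSum_factoredNumbers_prod_filter_prime_tsum` applied to `|f|`).
Ref: the standard majorant argument for absolutely convergent Euler products, e.g. Neukirch VII §8
(8.1)–(8.2). [folklore] -/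
theorem summable_norm_of_summable_norm_prime_pow {f : ℕ → ℂ} (hf₁ : f 1 = 1)
    (hmul : ∀ {m n : ℕ}, m.Coprime n → f (m * n) = f m * f n)
    (hp : ∀ {p : ℕ}, p.Prime → Summable fun k : ℕ => ‖f (p ^ k)‖) {B : ℝ}
    (hB : ∀ s : Finset ℕ, ∏ p ∈ s with p.Prime, ∑' k : ℕ, ‖f (p ^ k)‖ ≤ B) :
    Summable fun n => ‖f n‖ := by
  set g : ℕ → ℝ := fun n => ‖f n‖ with hg
  have hg₁ : g 1 = 1 := by simp [hg, hf₁]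
  have hgmul : ∀ {m n : ℕ}, m.Coprime n → g (m * n) = g m * g n := fun hmn => by
    simp only [hg, hmul hmn, norm_mul]
  have hgp : ∀ {p : ℕ}, p.Prime → Summable fun k : ℕ => ‖g (p ^ k)‖ := fun hp' => by
    simpa only [hg, norm_norm] using hp hp'
  have hB0 : 0 ≤ B := le_trans zero_le_one (by simpa using hB ∅)
  refine summable_of_sum_range_le (fun _ => norm_nonneg _) (c := ‖f 0‖ + B) fun N => ?_
  cases N with
  | zero => simpa using add_nonneg (norm_nonneg (f 0)) hB0
  | succ N =>
    -- the sum of `|f|` over the `{p ≤ N}`-factored numbers is an Euler product, bounded by `B`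
    obtain ⟨hsum, hhas⟩ :=
      EulerProduct.summable_and_hasSum_factoredNumbers_prod_filter_prime_tsum hg₁ hgmul hgp
        (Finset.range (N + 1))
    have htot : ∑' m : Nat.factoredNumbers (Finset.range (N + 1)), g m ≤ B := by
      rw [hhas.tsum_eq]
      have hB' := hB (Finset.range (N + 1))
      simp only [hg] at hB' ⊢
      exact hB'
    -- every `1 ≤ n ≤ N` is `{p ≤ N}`-factored
    have hmem : ∀ i ∈ Finset.range N, i + 1 ∈ Nat.factoredNumbers (Finset.range (N + 1)) := by
      intro i hi
      rw [Nat.mem_factoredNumbers']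
      intro p _ hpd
      rw [Finset.mem_range] at hi ⊢
      have : p ≤ i + 1 := Nat.le_of_dvd (Nat.succ_pos i) hpd
      omega
    have hsumc : Summable (g ∘ (Subtype.val : Nat.factoredNumbers (Finset.range (N + 1)) → ℕ)) := by
      simpa only [hg, norm_norm, Function.comp_def] using hsum
    have hsum' : Summable ((Nat.factoredNumbers (Finset.range (N + 1))).indicator g) :=
      summable_subtype_iff_indicator.mp hsumc
    rw [Finset.sum_range_succ', add_comm]
    refine add_le_add le_rfl ?_
    calc ∑ i ∈ Finset.range N, ‖f (i + 1)‖
        = ∑ i ∈ Finset.range N, (Nat.factoredNumbers (Finset.range (N + 1))).indicator g (i + 1) := by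
          refine Finset.sum_congr rfl fun i hi => ?_
          rw [Set.indicator_of_mem (hmem i hi)]
      _ = ∑ j ∈ (Finset.range N).map ⟨(· + 1), add_left_injective 1⟩,
            (Nat.factoredNumbers (Finset.range (N + 1))).indicator g j := by
          rw [Finset.sum_map]
          rfl
      _ ≤ ∑' j, (Nat.factoredNumbers (Finset.range (N + 1))).indicator g j :=
          hsum'.sum_le_tsum _ fun j _ => Set.indicator_nonneg (fun _ _ => norm_nonneg _) j
      _ = ∑' m : Nat.factoredNumbers (Finset.range (N + 1)), g m := (_root_.tsum_subtype _ g).symm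
      _ ≤ B := htot

/-- **Bounded Euler products from summable local excesses**: if `∑_k |f(p^k)| ≤ 1 + t_p` with
`t_p ≥ 0` summable over the primes, then `∏_{p ∈ s prime} ∑_k |f(p^k)| ≤ exp(∑_p t_p)` for every
finite set `s` (`1 + t ≤ e^t`). [folklore] -/
theorem prod_tsum_norm_prime_pow_le_exp {f : ℕ → ℂ} {t : Nat.Primes → ℝ} (ht0 : ∀ p, 0 ≤ t p)
    (ht : Summable t) (hle : ∀ p : Nat.Primes, ∑' k : ℕ, ‖f ((p : ℕ) ^ k)‖ ≤ 1 + t p)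
    (s : Finset ℕ) :
    ∏ p ∈ s with p.Prime, ∑' k : ℕ, ‖f (p ^ k)‖ ≤ Real.exp (∑' p, t p) := by
  rw [prod_filter_prime_eq_prod_subtype (fun p => ∑' k : ℕ, ‖f (p ^ k)‖) s]
  set s' : Finset Nat.Primes := s.subtype Nat.Prime with hs'
  calc ∏ q ∈ s', ∑' k : ℕ, ‖f ((q : ℕ) ^ k)‖ ≤ ∏ q ∈ s', Real.exp (t q) := by
        refine Finset.prod_le_prod (fun q _ => tsum_nonneg fun _ => norm_nonneg _) fun q _ => ?_
        exact (hle q).trans (by linarith [Real.add_one_le_exp (t q)])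
    _ = Real.exp (∑ q ∈ s', t q) := (Real.exp_sum _ _).symm
    _ ≤ Real.exp (∑' q, t q) := Real.exp_le_exp.mpr (ht.sum_le_tsum _ fun q _ => ht0 q)

/-- `(k + 1)^d = O(k^d)` along `atTop`, in the cast form wanted by
`summable_norm_mul_geometric_of_norm_lt_one`. [folklore] -/
theorem isBigO_natCast_add_pow (c d : ℕ) :
    (fun k : ℕ => (((k + c) ^ d : ℕ) : ℝ)) =O[atTop] fun k : ℕ => ((k ^ d : ℕ) : ℝ) := by
  simp only [Nat.cast_pow, Nat.cast_add]
  refine Asymptotics.IsBigO.pow ?_ _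
  refine Asymptotics.IsBigO.add (Asymptotics.isBigO_refl _ _) (Asymptotics.IsBigO.of_bound c ?_)
  filter_upwards [Filter.eventually_ge_atTop 1] with k hk
  simp only [Real.norm_natCast]
  have : (1 : ℝ) ≤ k := Nat.one_le_cast.mpr hk
  have hc : (0 : ℝ) ≤ c := Nat.cast_nonneg c
  nlinarith

/-- `∑_j (j + c)^d x^j` converges absolutely for `|x| < 1`. [folklore] -/
theorem summable_natCast_add_pow_mul_pow (c d : ℕ) {x : ℝ} (hx : ‖x‖ < 1) :
    Summable fun j : ℕ => ((j : ℝ) + c) ^ d * x ^ j := by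
  have h : Summable fun j : ℕ => ‖(((j + c) ^ d : ℕ) : ℝ) * x ^ j‖ :=
    summable_norm_mul_geometric_of_norm_lt_one (k := d) hx (isBigO_natCast_add_pow c d)
  refine h.of_norm.congr fun j => ?_
  push_cast
  ring

namespace ArtinRep

variable {V : Type w} [AddCommGroup V] [Module ℂ V] [TopologicalSpace V] [FiniteDimensional ℂ V]

/-! ### The Dirichlet series on `Re s > 1` -/

/-- **The local series at a prime**: for `Re s > 1` and a prime `p`,
`∑_k |a_{p^k} p^{-ks}| ≤ 1 + K p^{-Re s}` with `K = ∑_j (j+2)^{dim V} 2^{-j}`, and the series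
converges absolutely (`|a_{p^k}| ≤ (k+1)^{dim V}`, `p^{-Re s} ≤ 1/2`). [folklore] -/
theorem tsum_norm_term_prime_pow_le [IsModuleTopology ℂ V] (ρ : ArtinRep ℚ V) {s : ℂ}
    (hs : 1 < s.re) (p : Nat.Primes) :
    Summable (fun k : ℕ => ‖LSeries.term ρ.dirichletCoeff s ((p : ℕ) ^ k)‖) ∧
      ∑' k : ℕ, ‖LSeries.term ρ.dirichletCoeff s ((p : ℕ) ^ k)‖ ≤
        1 + (∑' j : ℕ, ((j : ℝ) + 2) ^ finrank ℂ V * (1 / 2 : ℝ) ^ j) * ((p : ℕ) : ℝ) ^ (-s.re) := by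
  have hp : (p : ℕ).Prime := p.2
  set v := (primesEquiv (R := 𝓞 ℚ)).symm p with hv
  set x : ℝ := ((p : ℕ) : ℝ) ^ (-s.re) with hx
  have hp0 : (0 : ℝ) < (p : ℕ) := by exact_mod_cast hp.pos
  have hp2 : (2 : ℝ) ≤ (p : ℕ) := by exact_mod_cast hp.two_le
  have hx0 : 0 ≤ x := Real.rpow_nonneg hp0.le _
  have hxhalf : x ≤ 1 / 2 := by
    rw [hx, Real.rpow_neg hp0.le, one_div]
    refine inv_anti₀ (by norm_num) ?_
    calc (2 : ℝ) ≤ (p : ℕ) := hp2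
      _ = ((p : ℕ) : ℝ) ^ (1 : ℝ) := (Real.rpow_one _).symm
      _ ≤ ((p : ℕ) : ℝ) ^ s.re := Real.rpow_le_rpow_of_exponent_le (by linarith) hs.le
  have hx1 : x < 1 := by linarith
  -- the terms at `p^k`
  have hterm : ∀ k : ℕ, ‖LSeries.term ρ.dirichletCoeff s ((p : ℕ) ^ k)‖ =
      ‖ρ.localCoeff v k‖ * x ^ k := by
    intro k
    rw [LSeries.term_of_ne_zero (pow_ne_zero k hp.ne_zero), norm_div, dirichletCoeff_prime_pow ρ hp k,
      Complex.norm_natCast_cpow_of_pos (pow_pos hp.pos k), div_eq_mul_inv, hx, Nat.cast_pow,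
      ← Real.rpow_natCast ((p : ℕ) : ℝ) k, ← Real.rpow_mul hp0.le, ← Real.rpow_neg hp0.le,
      ← Real.rpow_natCast (((p : ℕ) : ℝ) ^ (-s.re)) k, ← Real.rpow_mul hp0.le]
    congr 2
    ring
  have hsum' : Summable fun k : ℕ => ‖ρ.localCoeff v k‖ * x ^ k := by
    have hgeo := summable_natCast_add_pow_mul_pow 1 (finrank ℂ V)
      (by rw [Real.norm_eq_abs, abs_of_nonneg hx0]; exact hx1)
    refine hgeo.of_nonneg_of_le (fun k => mul_nonneg (norm_nonneg _) (pow_nonneg hx0 k)) fun k => ?_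
    push_cast
    exact mul_le_mul_of_nonneg_right (ρ.norm_localCoeff_le v k) (pow_nonneg hx0 k)
  have hsum : Summable fun k : ℕ => ‖LSeries.term ρ.dirichletCoeff s ((p : ℕ) ^ k)‖ := by
    simpa only [hterm] using hsum'
  refine ⟨hsum, ?_⟩
  -- split off `k = 0` and bound the tail by `K x`
  simp_rw [hterm]
  rw [hsum'.tsum_eq_zero_add, localCoeff_zero, norm_one, pow_zero, mul_one]
  refine add_le_add le_rfl ?_
  have hK := summable_natCast_add_pow_mul_pow 2 (finrank ℂ V) (x := 1 / 2) (by norm_num)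
  have htail : ∀ k : ℕ, ‖ρ.localCoeff v (k + 1)‖ * x ^ (k + 1) ≤
      (((k : ℝ) + 2) ^ finrank ℂ V * (1 / 2 : ℝ) ^ k) * x := by
    intro k
    calc ‖ρ.localCoeff v (k + 1)‖ * x ^ (k + 1)
        ≤ (((k + 1 : ℕ) : ℝ) + 1) ^ finrank ℂ V * x ^ (k + 1) :=
          mul_le_mul_of_nonneg_right (ρ.norm_localCoeff_le v (k + 1)) (pow_nonneg hx0 _)
      _ = ((k : ℝ) + 2) ^ finrank ℂ V * (x ^ k * x) := by push_cast; ring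
      _ ≤ ((k : ℝ) + 2) ^ finrank ℂ V * ((1 / 2 : ℝ) ^ k * x) := by gcongr
      _ = (((k : ℝ) + 2) ^ finrank ℂ V * (1 / 2 : ℝ) ^ k) * x := by ring
  calc ∑' k : ℕ, ‖ρ.localCoeff v (k + 1)‖ * x ^ (k + 1)
      ≤ ∑' k : ℕ, (((k : ℝ) + 2) ^ finrank ℂ V * (1 / 2 : ℝ) ^ k) * x :=
        ((summable_nat_add_iff 1).mpr hsum').tsum_le_tsum htail (by push_cast at hK; exact hK.mul_right x)
    _ = (∑' j : ℕ, ((j : ℝ) + 2) ^ finrank ℂ V * (1 / 2 : ℝ) ^ j) * x := by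
        rw [tsum_mul_right]

/-- The summands `a_n n^{-s}` are multiplicative on coprime arguments, and `a_1 1^{-s} = 1`.
[folklore] -/
theorem term_dirichletCoeff_mul_of_coprime (ρ : ArtinRep ℚ V) (s : ℂ) :
    LSeries.term ρ.dirichletCoeff s 1 = 1 ∧
      ∀ {m n : ℕ}, m.Coprime n → LSeries.term ρ.dirichletCoeff s (m * n) =
        LSeries.term ρ.dirichletCoeff s m * LSeries.term ρ.dirichletCoeff s n := by
  refine ⟨by rw [LSeries.term_of_ne_zero one_ne_zero, dirichletCoeff_one, Nat.cast_one, one_cpow,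
    div_one], fun {m n} hmn => ?_⟩
  rcases eq_or_ne m 0 with rfl | hm
  · simp [LSeries.term_zero]
  rcases eq_or_ne n 0 with rfl | hn
  · simp [LSeries.term_zero]
  rw [LSeries.term_of_ne_zero (mul_ne_zero hm hn), LSeries.term_of_ne_zero hm,
    LSeries.term_of_ne_zero hn, dirichletCoeff_mul_of_coprime ρ hmn, Nat.cast_mul,
    Complex.natCast_mul_natCast_cpow]
  ring

/-- **Absolute convergence of `∑ a_n n^{-s}` for `Re s > 1`** (Booker 2003, (4); Neukirch VII §10,
remark after (10.1): the Euler product of an Artin representation converges absolutely for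
`Re s > 1`).  Through `summable_norm_of_summable_norm_prime_pow`: the local series are bounded by
`1 + K p^{-Re s}` (`tsum_norm_term_prime_pow_le`) and `∑_p p^{-Re s} < ∞`
(Mathlib `Nat.Primes.summable_rpow`). [cite: Booker2003, eq. (4) p. 1091] -/
theorem LSeriesSummable_dirichletCoeff [IsModuleTopology ℂ V] (ρ : ArtinRep ℚ V) {s : ℂ}
    (hs : 1 < s.re) : LSeriesSummable ρ.dirichletCoeff s := by
  rw [LSeriesSummable, ← summable_norm_iff]
  set K : ℝ := ∑' j : ℕ, ((j : ℝ) + 2) ^ finrank ℂ V * (1 / 2 : ℝ) ^ j with hK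
  have hK0 : 0 ≤ K := tsum_nonneg fun j => by positivity
  obtain ⟨h1, hmul⟩ := ρ.term_dirichletCoeff_mul_of_coprime s
  refine summable_norm_of_summable_norm_prime_pow h1 hmul
    (fun hp => (ρ.tsum_norm_term_prime_pow_le hs ⟨_, hp⟩).1)
    (B := Real.exp (∑' p : Nat.Primes, K * ((p : ℕ) : ℝ) ^ (-s.re))) fun t => ?_
  refine prod_tsum_norm_prime_pow_le_exp (fun p => by positivity) ?_
    (fun p => (ρ.tsum_norm_term_prime_pow_le hs p).2) t
  exact (Nat.Primes.summable_rpow.mpr (by linarith)).mul_left K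

/-- The local Euler factor of the Dirichlet series at a prime: for `Re s > 1`,
`∑_k a_{p^k} p^{-ks} = L_p(ρ, p^{-s})⁻¹`. [cite: Booker2003, eq. (4) p. 1091] -/
theorem tsum_term_prime_pow_eq [IsModuleTopology ℂ V] (ρ : ArtinRep ℚ V) {s : ℂ} (hs : 1 < s.re)
    (p : Nat.Primes) :
    ∑' k : ℕ, LSeries.term ρ.dirichletCoeff s ((p : ℕ) ^ k) =
      ((ρ.eulerFactorAt ((primesEquiv (R := 𝓞 ℚ)).symm p)).eval (((p : ℕ) : ℂ) ^ (-s)))⁻¹ := by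
  have hp : (p : ℕ).Prime := p.2
  have hz : ‖((p : ℕ) : ℂ) ^ (-s)‖ < 1 := by
    rw [Complex.norm_natCast_cpow_of_pos hp.pos, Complex.neg_re]
    exact Real.rpow_lt_one_of_one_lt_of_neg (by exact_mod_cast hp.one_lt) (by linarith)
  rw [← ρ.tsum_localCoeff_mul_pow ((primesEquiv (R := 𝓞 ℚ)).symm p) hz]
  refine tsum_congr fun k => ?_
  rw [LSeries.term_of_ne_zero (pow_ne_zero k hp.ne_zero), dirichletCoeff_prime_pow ρ hp k,
    div_eq_mul_inv, ← Complex.cpow_neg, Nat.cast_pow, ← Complex.natCast_cpow_natCast_mul,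
    ← Complex.cpow_nat_mul]
  rfl

/-- **`∑ a_n n^{-s} = L(s, ρ)` for `Re s > 1`**: the Dirichlet series of the coefficients
`a_n = dirichletCoeff ρ n` is the Artin L-function (the Euler product over the finite places of
`ℚ`, `artinLFunction`) — Booker 2003, eq. (4): "`a_n` the Dirichlet coefficients of `L(s, ρ)`".
Mathlib's `EulerProduct.eulerProduct_hasProd` for the multiplicative summands `a_n n^{-s}` gives
`∑ a_n n^{-s} = ∏_p ∑_k a_{p^k} p^{-ks}`, each local series is `L_p(ρ, p^{-s})⁻¹`
(`tsum_term_prime_pow_eq`), and the product over rational primes is the product over the places of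
`ℚ` (`Rat.HeightOneSpectrum.primesEquiv`, `N v = p`).
[cite: Booker2003, eq. (4) p. 1091] [cite: NeukirchANT1999, VII §10 (10.1)] -/
theorem LSeries_dirichletCoeff_eq_artinLFunction [IsModuleTopology ℂ V] (ρ : ArtinRep ℚ V)
    {s : ℂ} (hs : 1 < s.re) : LSeries ρ.dirichletCoeff s = artinLFunction ρ s := by
  have hsum : Summable fun n => ‖LSeries.term ρ.dirichletCoeff s n‖ :=
    summable_norm_iff.mpr (ρ.LSeriesSummable_dirichletCoeff hs)
  obtain ⟨h1, hmul⟩ := ρ.term_dirichletCoeff_mul_of_coprime s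
  have hEP := EulerProduct.eulerProduct_hasProd h1 hmul hsum (LSeries.term_zero _ _)
  have hL : LSeries ρ.dirichletCoeff s =
      ∏' p : Nat.Primes, ∑' k : ℕ, LSeries.term ρ.dirichletCoeff s ((p : ℕ) ^ k) :=
    hEP.tprod_eq.symm
  have hA : artinLFunction ρ s = ∏' p : Nat.Primes,
      ((ρ.eulerFactorAt ((primesEquiv (R := 𝓞 ℚ)).symm p)).eval (((p : ℕ) : ℂ) ^ (-s)))⁻¹ := by
    unfold artinLFunction
    rw [← Equiv.tprod_eq (primesEquiv (R := 𝓞 ℚ)).symm]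
    refine tprod_congr fun p => ?_
    rw [Rat.residueCard_eq_natGenerator', Rat.natGenerator_primesEquiv_symm]
  rw [hL, hA]
  exact tprod_congr fun p => ρ.tsum_term_prime_pow_eq hs p

end ArtinRep

end Literature.NumberTheory.GaloisRepresentations

end
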